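import Summits.QuantumAdvantage.QuantumAdvantage.Theorems.SteerDialRotList

/-!
# SteerDial (9): SteerDialTagLaw — the TAG LAW (fixed-position steering certificates are REFUTED) and the cover bridge

Part 9 of the prover-side twin of the lineage decomp-qadv-lens-5 steering programme, generation 9, workshop node
«TagDial» §4–§5 (rev 3 sha256 6a47a487…).  Two results, all sorry-free:
* `tagLaw` (exact, every `n, L, m, T`): the Boolean degree-`L` test `ψ_tag = 1 − x_{n−L}⋯x_{n−1}` has
  `2^(n+m) ≤ #{ψ_tag = 1} + 2^(n−L)·2^m` and `2^(n−L) ≤ #{y : ∀ t, ψ_tag(pad uₜ y) ≠ 1}` for EVERY un-rotated word list;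
* `steerDial_not_fixedNoSat3` — NEGATIVE KNOWLEDGE for item 30909: the fixed-window covering statement («some polylog list
  of words covers every dense polylog-degree algebraic event up to `2^n/n^{k'}` bodies») is FALSE (tag test, `L = log₂ n`,
  `k' = 2`); position-adaptivity of the windows is necessary;
(v2: the rev-1 conditional bridge `steerDial_algCover3_of_adaptiveNoSat3` is DROPPED — its hypothesis, the workshop's
`AdaptiveNoSat3`, is refuted by body-only rotation-invariant tests (critic row 60 / node rev 3); the repaired bridge is
part 11 `SteerDialInvBridge`.)
No `def … : Prop`, no `instance`, no `notation`.
-/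

set_option linter.style.longLine false
set_option linter.dupNamespace false

namespace Summit.QuantumAdvantage.QuantumAdvantage.Theorems.SteerDial

open Finset
open Literature.Computability.QuantumComplexity Literature.Computability.MetaComplexity
open Literature.Computability.QuantumComplexity.RingHLF
open Summit.QuantumAdvantage.AdviceFreeQNC0
open Summit.QuantumAdvantage.QuantumAdvantage.Theses

/-! ## §1  The TAG LAW: un-rotated certificates are defeated by one planted tag — PROVED -/

section Tag
variable {n L m T : ℕ}

/-- The tag block: the last `L` body positions `n-L, …, n-1` of `C_{n+m}` (all body positions if `L > n`). -/
def tagBlock (n L m : ℕ) : Finset (Fin (n + m)) := univ.filter fun b => n - L ≤ b.val ∧ b.val < n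

/-- SteerDial helper `card_tagBlock_le` (lens-5 g7 SteerDial twin; see the enclosing section docstring). -/
theorem card_tagBlock_le : (tagBlock n L m).card ≤ L := by
  calc (tagBlock n L m).card ≤ (Finset.range L).card :=
        Finset.card_le_card_of_injOn (fun b => b.val - (n - L))
          (fun b hb => by
            have h := (Finset.mem_filter.1 (Finset.mem_coe.1 hb)).2
            simp only [Finset.mem_coe, Finset.mem_range]; omega)
          (fun b hb b' hb' h => by
            have h1 := (Finset.mem_filter.1 (Finset.mem_coe.1 hb)).2
            have h2 := (Finset.mem_filter.1 (Finset.mem_coe.1 hb')).2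
            exact Fin.ext (by simp only at h; omega))
    _ = L := Finset.card_range L

/-- The TAG TEST `ψ_tag = 1 − ∏_{b ∈ tag block} x_b`: degree `≤ L`, Boolean-valued, `ψ_tag x = 1 ↔` the tag block of `x`
is not all-ones. -/
def tagTest (n L m : ℕ) : Smolensky.CubeFn (ZMod 3) (n + m) := 1 - Smolensky.mono (ZMod 3) (tagBlock n L m)

/-- SteerDial helper `tagTest_mem_lowDeg` (lens-5 g7 SteerDial twin; see the enclosing section docstring). -/
theorem tagTest_mem_lowDeg : tagTest n L m ∈ Smolensky.lowDeg (ZMod 3) (n + m) L :=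
  Submodule.sub_mem _ (one_mem_lowDeg _) (Smolensky.mono_mem_lowDeg (F := ZMod 3) card_tagBlock_le)

/-- SteerDial helper `tagTest_boolean` (lens-5 g7 SteerDial twin; see the enclosing section docstring). -/
theorem tagTest_boolean (x : Fin (n + m) → Bool) : tagTest n L m x = 0 ∨ tagTest n L m x = 1 := by
  unfold tagTest
  rw [Pi.sub_apply, Pi.one_apply, Smolensky.mono_apply]
  by_cases h : ∀ i ∈ tagBlock n L m, x i = true
  · rw [if_pos h]; left; simp
  · rw [if_neg h]; right; simp

/-- SteerDial helper `tagTest_ne_one_iff` (lens-5 g7 SteerDial twin; see the enclosing section docstring). -/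
theorem tagTest_ne_one_iff (x : Fin (n + m) → Bool) : tagTest n L m x ≠ 1 ↔ ∀ i ∈ tagBlock n L m, x i = true := by
  unfold tagTest
  rw [Pi.sub_apply, Pi.one_apply, Smolensky.mono_apply]
  by_cases h : ∀ i ∈ tagBlock n L m, x i = true
  · rw [if_pos h]
    exact ⟨fun _ => h, fun _ => by decide⟩
  · rw [if_neg h]
    exact ⟨fun h' => absurd (by decide : (1 : ZMod 3) - 0 = 1) h', fun h' => absurd h' h⟩

/-- Fill a prefix assignment with an all-ones tag. -/
def fill (n L : ℕ) (y₀ : Fin (n - L) → Bool) : Fin n → Bool := fun i => if h : i.val < n - L then y₀ ⟨i.val, h⟩ else true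

/-- SteerDial helper `fill_injective` (lens-5 g7 SteerDial twin; see the enclosing section docstring). -/
theorem fill_injective (n L : ℕ) : Function.Injective (fill n L) := by
  intro y₀ y₀' h
  funext i
  have e := congrFun h ⟨i.val, lt_of_lt_of_le i.2 (Nat.sub_le n L)⟩
  simpa [fill, i.2] using e

/-- Tagged bodies are BAD for every un-rotated word: the padded pattern fails the tag test. -/
theorem tagTest_pad_fill (w : Fin m → Bool) (y₀ : Fin (n - L) → Bool) : tagTest n L m (pad w (fill n L y₀)) ≠ 1 := by
  rw [tagTest_ne_one_iff]
  intro b hb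
  have h := (Finset.mem_filter.1 hb).2
  have e : b = Fin.castAdd m ⟨b.val, h.2⟩ := Fin.ext (by simp)
  rw [e, pad_castAdd]
  simp [fill, show ¬ (b.val < n - L) by omega]

/-- **Bad-set bound**: `2^(n-L) ≤ #{y : ∀ t, ψ_tag (pad uₜ y) ≠ 1}` for EVERY list `u` of words (any length `T`). -/
theorem card_bad_tag (u : Fin T → Fin m → Bool) :
    2 ^ (n - L) ≤ (univ.filter fun y : Fin n → Bool => ∀ t : Fin T, tagTest n L m (pad (u t) y) ≠ 1).card := by
  calc 2 ^ (n - L) = (univ.image (fill n L)).card := by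
        rw [Finset.card_image_of_injective _ (fill_injective n L)]; simp
    _ ≤ _ := Finset.card_le_card fun y hy => by
        obtain ⟨y₀, -, rfl⟩ := Finset.mem_image.1 hy
        exact Finset.mem_filter.2 ⟨mem_univ _, fun t => tagTest_pad_fill (u t) y₀⟩

/-- **Density bound**: `2^(n+m) ≤ #{ψ_tag = 1} + 2^(n-L)·2^m`. -/
theorem card_tagTest_one :
    2 ^ (n + m) ≤ (univ.filter fun x : Fin (n + m) → Bool => tagTest n L m x = 1).card + 2 ^ (n - L) * 2 ^ m := by
  classical
  have hsplit := Finset.card_filter_add_card_filter_not (s := (univ : Finset (Fin (n + m) → Bool)))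
    (fun x => tagTest n L m x = 1)
  have hu : (univ : Finset (Fin (n + m) → Bool)).card = 2 ^ (n + m) := by simp
  rw [hu] at hsplit
  -- the complement injects into (prefix, window) pairs
  have hcompl : (univ.filter fun x : Fin (n + m) → Bool => ¬ tagTest n L m x = 1).card ≤ 2 ^ (n - L) * 2 ^ m := by
    have hcard : (univ : Finset ((Fin (n - L) → Bool) × (Fin m → Bool))).card = 2 ^ (n - L) * 2 ^ m := by
      simp [Fintype.card_prod]
    rw [← hcard]
    refine Finset.card_le_card_of_injOn
      (fun x => (fun i : Fin (n - L) => x ⟨i.val, by omega⟩, fun j : Fin m => x (Fin.natAdd n j)))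
      (fun x _ => Finset.mem_coe.2 (mem_univ _)) (fun x hx x' hx' hxx => ?_)
    have tx := (tagTest_ne_one_iff x).1 (Finset.mem_filter.1 (Finset.mem_coe.1 hx)).2
    have tx' := (tagTest_ne_one_iff x').1 (Finset.mem_filter.1 (Finset.mem_coe.1 hx')).2
    simp only [Prod.mk.injEq] at hxx
    funext b
    rcases lt_or_ge b.val (n - L) with h1 | h1
    · exact congrFun hxx.1 ⟨b.val, h1⟩
    · rcases lt_or_ge b.val n with h2 | h2
      · have hb : b ∈ tagBlock n L m := Finset.mem_filter.2 ⟨mem_univ _, h1, h2⟩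
        rw [tx b hb, tx' b hb]
      · have e : b = Fin.natAdd n ⟨b.val - n, by omega⟩ := Fin.ext (by simp; omega)
        rw [e]
        exact congrFun hxx.2 ⟨b.val - n, by omega⟩
  omega

/-- **THE TAG LAW (exact, every `n, L, m` and every un-rotated list of any length).** -/
theorem tagLaw (n L m T : ℕ) (u : Fin T → Fin m → Bool) :
    tagTest n L m ∈ Smolensky.lowDeg (ZMod 3) (n + m) L ∧
    (∀ x, tagTest n L m x = 0 ∨ tagTest n L m x = 1) ∧
    2 ^ (n + m) ≤ (univ.filter fun x : Fin (n + m) → Bool => tagTest n L m x = 1).card + 2 ^ (n - L) * 2 ^ m ∧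
    2 ^ (n - L) ≤ (univ.filter fun y : Fin n → Bool => ∀ t : Fin T, tagTest n L m (pad (u t) y) ≠ 1).card :=
  ⟨tagTest_mem_lowDeg, tagTest_boolean, card_tagTest_one, card_bad_tag u⟩

end Tag

/-! ## §2  The fixed-position covering statement is FALSE -/

section Node

/-- **NEGATIVE KNOWLEDGE (item 30909).**  The fixed-window covering statement is false: tag test with `L = log₂ n` tag
bits, exponent `k' = 2`, degree exponent `c = 1`. -/
theorem steerDial_not_fixedNoSat3 : ¬ (
    ∃ η : ℝ, 0 < η ∧ ∀ k' : ℕ, ∃ m : ℕ, ∃ c₁ : ℕ, ∀ c : ℕ, ∃ n₀ : ℕ, ∀ n ≥ n₀,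
        ∀ ψ : Smolensky.CubeFn (ZMod 3) (n + m), ψ ∈ Smolensky.lowDeg (ZMod 3) (n + m) ((Nat.log 2 (n + m)) ^ c) →
          (1 - η) * (2 : ℝ) ^ (n + m) ≤ ((univ.filter fun x : Fin (n + m) → Bool => ψ x = 1).card : ℝ) →
            ∃ T : ℕ, T ≤ (Nat.log 2 n) ^ c₁ ∧ ∃ u : Fin T → Fin m → Bool,
              ((univ.filter fun y : Fin n → Bool => ∀ t : Fin T, ψ (pad (u t) y) ≠ 1).card : ℝ) ≤
                1 / (n : ℝ) ^ k' * (2 : ℝ) ^ n) := by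
  rintro ⟨η, hη, h⟩
  obtain ⟨m, c₁, hc⟩ := h 2
  obtain ⟨n₀, hn₀⟩ := hc 1
  -- a large body length
  set n := max n₀ (max 2 ⌈2 / η⌉₊) with hn_def
  have hn0 : n₀ ≤ n := le_max_left _ _
  have hn2 : 2 ≤ n := le_trans (le_max_left _ _) (le_max_right _ _)
  have hnη : (2 : ℝ) / η ≤ n := le_trans (Nat.le_ceil _) (by exact_mod_cast le_trans (le_max_right _ _) (le_max_right _ _))
  set L := Nat.log 2 n with hL
  have hLn : L ≤ n := (Nat.log_lt_of_lt_pow (by omega) Nat.lt_two_pow_self).le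
  have hpowL : 2 ^ L ≤ n := Nat.pow_log_le_self 2 (by omega)
  have hpowL' : n < 2 ^ (L + 1) := Nat.lt_pow_succ_log_self (by norm_num) n
  -- the tag test
  have hdeg : tagTest n L m ∈ Smolensky.lowDeg (ZMod 3) (n + m) ((Nat.log 2 (n + m)) ^ 1) := by
    refine Smolensky.lowDeg_mono ?_ tagTest_mem_lowDeg
    rw [pow_one]
    exact Nat.log_mono_right (by omega)
  have hdense : (1 - η) * (2 : ℝ) ^ (n + m) ≤
      ((univ.filter fun x : Fin (n + m) → Bool => tagTest n L m x = 1).card : ℝ) := by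
    have h1 : ((2 ^ (n + m) : ℕ) : ℝ) ≤
        ((univ.filter fun x : Fin (n + m) → Bool => tagTest n L m x = 1).card : ℝ) + ((2 ^ (n - L) * 2 ^ m : ℕ) : ℝ) := by
      exact_mod_cast (card_tagTest_one (n := n) (L := L) (m := m))
    push_cast at h1
    -- η · 2^(n+m) ≥ 2^(n-L) · 2^m  since  η · 2^L ≥ η n / 2 ≥ 1
    have h2 : (2 : ℝ) ^ (n + m) = (2 : ℝ) ^ (n - L) * (2 : ℝ) ^ L * (2 : ℝ) ^ m := by
      rw [← pow_add, ← pow_add, Nat.sub_add_cancel hLn]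
    have h3 : (1 : ℝ) ≤ η * (2 : ℝ) ^ L := by
      have h4 : (n : ℝ) < 2 * (2 : ℝ) ^ L := by
        have h4' : ((n : ℕ) : ℝ) < ((2 ^ (L + 1) : ℕ) : ℝ) := by exact_mod_cast hpowL'
        push_cast at h4'
        rw [pow_succ] at h4'
        linarith
      have h5 : (2 : ℝ) ≤ η * n := by
        have := (div_le_iff₀ hη).1 hnη
        linarith
      nlinarith
    have h6 : (0 : ℝ) ≤ (2 : ℝ) ^ (n - L) * (2 : ℝ) ^ m := by positivity
    nlinarith
  obtain ⟨T, -, u, hBad⟩ := hn₀ n hn0 (tagTest n L m) hdeg hdense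
  have hbad : ((2 ^ (n - L) : ℕ) : ℝ) ≤
      ((univ.filter fun y : Fin n → Bool => ∀ t : Fin T, tagTest n L m (pad (u t) y) ≠ 1).card : ℝ) := by
    exact_mod_cast card_bad_tag (n := n) (L := L) (m := m) u
  push_cast at hbad
  -- 2^(n-L) ≤ 2^n / n^2 = 2^(n-L) · 2^L / n^2 ≤ 2^(n-L) / n : contradiction
  have h7 : (2 : ℝ) ^ n = (2 : ℝ) ^ (n - L) * (2 : ℝ) ^ L := by rw [← pow_add, Nat.sub_add_cancel hLn]
  have hnpos : (0 : ℝ) < n := by exact_mod_cast (by omega : 0 < n)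
  have h8 : ((2 : ℝ) ^ L) ≤ n := by exact_mod_cast hpowL
  have h9 : (2 : ℝ) ^ (n - L) ≤ 1 / (n : ℝ) ^ 2 * ((2 : ℝ) ^ (n - L) * (2 : ℝ) ^ L) := h7 ▸ hbad.trans hBad
  have h10 : (0 : ℝ) < (2 : ℝ) ^ (n - L) := by positivity
  have h11 : (n : ℝ) ^ 2 ≤ (2 : ℝ) ^ L := by
    have := h9
    rw [one_div, ← div_le_iff₀' (by positivity : (0 : ℝ) < ((n : ℝ) ^ 2)⁻¹), div_inv_eq_mul] at this
    nlinarith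
  have h12 : (2 : ℝ) ≤ n := by exact_mod_cast hn2
  nlinarith

end Node

end Summit.QuantumAdvantage.QuantumAdvantage.Theorems.SteerDial
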